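import Literature.MathematicalPhysics.QuantumFieldTheory.Balaban1983to89.B7Eq47AveragedBondVsStraight
import Literature.MathematicalPhysics.QuantumFieldTheory.Balaban1983to89.B7Eq44TorusAxialGaugeLocal
import Literature.MathematicalPhysics.QuantumFieldTheory.Balaban1983to89.B7AvgGaugeCovariance
import Literature.MathematicalPhysics.QuantumFieldTheory.Balaban1983to89.B9Eq315QTower

/-!
# `Balaban1983to89.B7Eq47BlockGaugeTowerBonds` — T. Bałaban, *Averaging operations for lattice gauge theories*, Commun. Math. Phys. **98** (1985) 17–51
# [Balaban1985Averaging] pp. 24–26 ((44), the axial gauge of p. 24, (47), (52)–(54)) with [Balaban1985BackgroundPropagators] (3.35)–(3.37) p. 396: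
# **IN THE AXIAL GAUGE OF ONE UNIT BLOCK, EVERY LEVEL-`j` AVERAGED BOND OVER THAT BLOCK IS `O(α₀·L^{−(j+1)})`-CLOSE TO `1` — FROM THE GAUGE-INVARIANT
# PLAQUETTE CLASS (52) ALONE** (the LENGTH count `L^{n−j}·d(L^{n+1} − 1)·δ` for the straight fine transporter + the AREA count of
# `B7Eq47AveragedBondVsStraight`): the displayed profile `‖Ū^j(b) − 1‖ ≤ ε_j`, `ε_j ≤ αr^j`, of the NE9 chain's k-level files, INHABITED LOCALLY with
# `r = 1∕L`, no level count, nothing but (52) and `2 ≤ m_i`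

statement-level skeleton of published theorems with citation tags; proofs where landed; nothing here is a claim about the Yang–Mills mass gap

CITATION HEADER (lean-in-tree rule).  Audit cell `pub-balaban`, sub-cell `t4`, BINDER row NE9; filed by NE9 formalisation-swarm leaf prover 03
(`b2b-balaban-t4-ne9-formalise-leaf-03`, gen 64), brick (T2) of the k-level Tier P programme (journal l.47756).  Sources READ in the held text:
[Balaban1985Averaging] pp. 24–26 (quoted verbatim in `B7Eq44TorusAxialGaugeLocal` ∕ `B7Prop2Explicit`), [Balaban1985BackgroundPropagators] p. 396
(`paper:balaban1985-cmp99-background-propagators` p0008).  Objects BY NAME: the owner's `towerP` ∕ `UlevOf`, the chain's `gaugeU` ∕ `plaqHolU`, the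
lit-balaban cell's `pdev` ∕ `avgIter` ∕ `AvgClosed` ∕ `perCfg` ∕ `perSite` ∕ `liftSite`, `B7Eq44TorusAxialGaugeLocal.axialGaugeTAt` ∕
`norm_gaugeU_axialGaugeTAt_sub_one_le_uniform`, this lineage's `B7Eq47AveragedBondVsStraight.norm_avgIter_sub_straight_le`; nothing re-declared, 0 `def`.

THE PRINT (verbatim).  [B7] p. 24: *«let us introduce locally the axial gauge with the initial point y … V₀(Γ_{y,x}) = 1»*; p. 25: *«for b ⊂ Δ(p′) we have
|V₀,b − 1| < |b₋ − y|α₀ ≦ dLα₀ … it is a local result»*; p. 26 (52): *«|U(∂p) − 1| < α₀η², η = L^{−k}»*.  [B9] p. 396 (3.35): *«there exists a gauge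
transformation u on □ such that U^u = e^{iηA}, |A| ≤ …»*; (3.37): the profile of the averaged configurations on the domains `Ω_j`.

WHAT IS PROVED (sorry-free; proof lane — 0 `def`; [folklore] torus arithmetic + composition of landed letters).
* §1 torus arithmetic of the unit block `B(y)` of `T_{L^{n+1}m}` (`N = L^{n+1}`): `val_blockOrigin`, `bounds_of_over` (`x_i div L^{j+1} = y_i` ⇒
  `L^{j+1}y_i ≤ x_i < L^{j+1}(y_i+1)`), `succ_lt_of_over_shift` (`2 ≤ m_κ` ⇒ the step `x + e_κ` over `y` does not wrap), `val_segSite`,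
  `liftSite_sub_of_le`, `segBond_in_box` (every fine bond of the straight contour of a level-`(j+1)` bond over `y`, stepping inside `y`, lies in the box
  `x₀(y) + [0, N−1]^d`).
* §2 **`norm_gaugeU_blockAxial_sub_one_le`** — FINE BONDS: for unit-bounded `U` with `‖U(∂p) − 1‖ ≤ δ` and `2 ≤ m_i`, every fine bond `(x, μ)` with `x` and
  `x + e_μ` over `y` satisfies `‖U^{u_y}(x, μ) − 1‖ ≤ d(N − 1)·δ` in the axial gauge `u_y` rooted at the block origin `x₀(y) = N·y`
  (`norm_gaugeU_axialGaugeTAt_sub_one_le_uniform`); `norm_hol_seg_blockAxial_sub_one_le` — the straight transporter of `ℓ = L^{n−j}` such bonds is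
  `ℓ·d(N−1)δ`-close to `1`.
* §3 **`norm_UlevOf_blockAxial_sub_one_le`** — LEVEL BONDS: under print's class (52) for the periodic extension (`U` valued in an averaging-closed
  subgroup `S` of the unit ball, `C₀α₀ ≤ ⅓`, `2α₀ ≤ c₂′`, `pdev Ũ < α₀N⁻²`) and `2 ≤ m_i`: for `j ≤ n` and every level-`(j+1)` bond `(z, κ)` with `z`,
  `z + e_κ` over `y`, `‖(UlevOf L m (n+1) (U^{u_y}) j)(z, κ) − 1‖ ≤ L^{n−j}·d(N−1)·pdev Ũ + 256(d+1)(d+4)·α₀·(L^{n−j}∕N)²` — the LENGTH count (§2) plus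
  the AREA count (`norm_avgIter_sub_straight_le` at `Ũ^{ũ_y}`, whose class data are those of `Ũ`: `pdev_gaugeAct`, holonomies of `S`-valued fields in `S`);
  **`norm_UlevOf_blockAxial_sub_one_le_profile`** — hence `≤ (d + 256(d+1)(d+4))·α₀·L^{n−j}∕N`: the chain's displayed profile over the block, ratio `1∕L`
  per level (`j = n` finest: `C·α₀∕N`; `j = 0` coarsest: `C·α₀∕L`) — NO level count.
WHY (cell context).  The NE9 chain's k-level files display `hUε : ‖U(b) − 1‖ ≤ αη` and `hLε : ‖Ū^j(b) − 1‖ ≤ ε_j ≤ αr^j` GLOBALLY (print's running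
gauge (3.36)–(3.37)); `B7Eq43AveragedSmallness` inhabits `hLε` from `hUε` with `(8(d+1)L)^k`.  This file inhabits BOTH, LOCALLY over one unit block in its
axial gauge, from the gauge-INVARIANT class (52) with level-free constants — the letters of the per-block argument for the `k`-level site operator ((T4)∕(T5))
through `B9Eq319QprimeTowerBlockLocal` ∕ `B9Eq332QprimeTowerGaugeCovariance`.  The `R`-road's GLOBAL displays are NOT discharged (torus holonomies).
HONEST SCOPE.  [folklore]; nothing of [B7] ∕ [B9] asserted hypothesis-free; `2 ≤ m_i` is essential (for `m_i = 1` the block wraps the torus and the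
Polyakov holonomy is not controlled by plaquettes).  NOT summit progress (cell pub-balaban: NE9 NOT PRINTED ∕ NOT PROVED; «NE9 ⇐ the named binders»;
spine PROVED 0/9; rung (B)+1 finite T⁴ — NOT infinite volume, NOT mass gap, NOT Clay; HONEST DEPENDENCY: continuum YM on T⁴ ⇐ BetaPertH ∧ nine spine
estimates (0/9 proved); BetaPertH ⇐ (D1) ∧ (D4) ∧ CAP+tail; G-an2-4 gates asym, D1 and NE2/3/4).  NEW file; nothing modified.  Net new unproved facts: 0.
-/

noncomputable section

open scoped BigOperators

namespace Literature.MathematicalPhysics.QuantumFieldTheory.Balaban1983to89.B7Eq47BlockGaugeTowerBonds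

open B4Sect5Torus (TSite)
open B9SectCLatticeCarrier (Bond shift shift_apply_val shift_apply_ne)
open B7Prop1Explicit (e e_apply hol seg U1 mem_U1 hol_mem gaugeAct plaqWord l1 hol_seg_succ seg_zero hol_nil)
open B7Prop2Explicit (pdev le_pdev avgIter C0 c2' AvgClosed hol_mem_of)
open B7AvgGaugeCovariance (pdev_gaugeAct)
open B9Eq315QTorus (perSite perCfg perCfg_apply)
open B9Eq315QTorusOnto (liftSite perSite_liftSite)
open B9Eq315QTower (towerP towerP_apply UlevOf)
open B9Eq310DeltaPrime (plaqHolU)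
open B9Eq328GaugeAction (gaugeU gaugeU_apply_dir)
open B7Eq44TorusAxialGauge (liftSite_nonneg hol_perCfg_plaqWord perCfg_gaugeU')
open B7Eq44TorusAxialGaugeLocal (axialGaugeTAt axialGaugeTAt_apply liftSite_perSite_of_lt norm_gaugeU_axialGaugeTAt_sub_one_le_uniform)
open B7Eq47AveragedBondVsStraight (norm_avgIter_sub_straight_le)

variable {d : ℕ} (L : ℕ) [NeZero L] (m : Fin d → ℕ) [∀ i, NeZero (m i)] (n : ℕ)

/-! ## §1 Torus arithmetic of the unit block -/

section Arith

omit [∀ i, NeZero (m i)] in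
/-- `L^{j+1}·y_i ≤ x_i < L^{j+1}·(y_i + 1)` when `x_i div L^{j+1} = y_i`. [folklore] -/
private theorem bounds_of_over {j : ℕ} {x : TSite d (towerP L m (j + 1))} {y : TSite d m} (hx : ∀ i, (x i : ℕ) / L ^ (j + 1) = (y i : ℕ)) (i : Fin d) :
    L ^ (j + 1) * (y i : ℕ) ≤ (x i : ℕ) ∧ (x i : ℕ) < L ^ (j + 1) * ((y i : ℕ) + 1) := by
  have hL : 0 < L ^ (j + 1) := pow_pos (Nat.pos_of_ne_zero (NeZero.ne L)) _
  constructor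
  · have := (Nat.le_div_iff_mul_le hL).1 (le_of_eq (hx i).symm); rw [mul_comm]; exact this
  · have := (Nat.div_lt_iff_lt_mul hL).1 (lt_of_eq_of_lt (hx i) (Nat.lt_succ_self _)); rw [mul_comm]; exact this

omit [∀ i, NeZero (m i)] in
/-- **no wrap**: if `x` and `x + e_κ` lie over the same unit site `y` and `2 ≤ m_κ`, then `x_κ + 1 < L^{j+1}(y_κ + 1)` (in particular the step does
not wrap around the torus). [folklore] -/
private theorem succ_lt_of_over_shift (hm : ∀ i, 2 ≤ m i) {j : ℕ} {x : TSite d (towerP L m (j + 1))} {y : TSite d m}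
    (hx : ∀ i, (x i : ℕ) / L ^ (j + 1) = (y i : ℕ)) (κ : Fin d) (hxκ : ∀ i, ((shift κ x) i : ℕ) / L ^ (j + 1) = (y i : ℕ)) :
    (x κ : ℕ) + 1 < L ^ (j + 1) * ((y κ : ℕ) + 1) := by
  have hP : towerP L m (j + 1) κ = L ^ (j + 1) * m κ := towerP_apply L m (j + 1) κ
  obtain ⟨_, h2⟩ := bounds_of_over L m hx κ
  have hs := shift_apply_val κ x
  have hxlt : (x κ : ℕ) < towerP L m (j + 1) κ := (x κ).isLt
  by_cases hwrap : (x κ : ℕ) + 1 < towerP L m (j + 1) κ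
  · -- no wrap: `(x + e_κ)_κ = x_κ + 1`
    obtain ⟨_, h4⟩ := bounds_of_over L m hxκ κ
    rwa [hs, Nat.mod_eq_of_lt hwrap] at h4
  · -- wrap: `(x + e_κ)_κ = 0`, so `y_κ = 0`, `x_κ < L^{j+1}`, `x_κ + 1 = L^{j+1}m_κ ≥ 2L^{j+1}` — contradiction
    exfalso
    have heq : (x κ : ℕ) + 1 = towerP L m (j + 1) κ := by omega
    have hy0 : (y κ : ℕ) = 0 := by have := hxκ κ; rw [hs, heq, Nat.mod_self, Nat.zero_div] at this; exact this.symm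
    rw [hy0, zero_add, mul_one] at h2
    have hm2 : 2 * L ^ (j + 1) ≤ L ^ (j + 1) * m κ := by rw [mul_comm]; exact Nat.mul_le_mul_left _ (hm κ)
    omega

/-- the coordinates of `perSite` of a small nonnegative vector are the vector's. [folklore] -/
private theorem val_perSite_of_lt {P : Fin d → ℕ} [∀ i, NeZero (P i)] {w : B7Prop1Explicit.Site d} (h0 : 0 ≤ w) (hw : ∀ i, w i < P i) (i : Fin d) :
    ((perSite P w i : ℕ) : ℤ) = w i :=
  congrFun (liftSite_perSite_of_lt P h0 hw) i

/-- **the block origin `x₀(y) = N·y`** (`N = L^{n+1}`): its coordinates are `N·y_i` (no wrap). [cite: Balaban1985Averaging, (2) p.17] -/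
theorem val_blockOrigin (y : TSite d m) (i : Fin d) :
    ((perSite (towerP L m (n + 1)) (((L : ℤ) ^ (n + 1)) • liftSite y) i : ℕ) : ℤ) = (L : ℤ) ^ (n + 1) * (y i : ℕ) := by
  have h0 : (0 : B7Prop1Explicit.Site d) ≤ ((L : ℤ) ^ (n + 1)) • liftSite y := fun i => by
    simp only [Pi.zero_apply, Pi.smul_apply, liftSite, smul_eq_mul]; positivity
  have hw : ∀ i, (((L : ℤ) ^ (n + 1)) • liftSite y) i < towerP L m (n + 1) i := fun i => by
    simp only [Pi.smul_apply, liftSite, smul_eq_mul, towerP_apply]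
    push_cast
    have := (y i).isLt
    have hL : (0 : ℤ) < (L : ℤ) ^ (n + 1) := pow_pos (by exact_mod_cast Nat.pos_of_ne_zero (NeZero.ne L)) _
    nlinarith
  rw [val_perSite_of_lt h0 hw]
  simp [liftSite]

/-- **a site of the straight contour of the level-`(j+1)` bond `(z, κ)`**: `x_t = L^{n−j}·z̃ + t·e_κ` for `t < L^{n−j}`, `j ≤ n` — its coordinates
(no wrap: `L^{n−j}(z_i + 1) ≤ L^{n+1}m_i`). [cite: Balaban1985Averaging, (43) p.24, (9) p.18] -/
theorem val_segSite {j : ℕ} (hj : j ≤ n) (z : TSite d (towerP L m (j + 1))) (κ : Fin d) {t : ℕ} (ht : t < L ^ (n - j)) (i : Fin d) :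
    ((perSite (towerP L m (n + 1)) (((L : ℤ) ^ (n - j)) • liftSite z + (t : ℤ) • e κ) i : ℕ) : ℤ) =
      (L : ℤ) ^ (n - j) * (z i : ℕ) + (if i = κ then (t : ℤ) else 0) := by
  have hpow : L ^ (n - j) * L ^ (j + 1) = L ^ (n + 1) := by rw [← pow_add]; congr 1; omega
  have h0 : (0 : B7Prop1Explicit.Site d) ≤ ((L : ℤ) ^ (n - j)) • liftSite z + (t : ℤ) • e κ := fun i => by
    simp only [Pi.zero_apply, Pi.add_apply, Pi.smul_apply, liftSite, smul_eq_mul, e_apply]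
    split_ifs <;> positivity
  have hw : ∀ i, (((L : ℤ) ^ (n - j)) • liftSite z + (t : ℤ) • e κ) i < towerP L m (n + 1) i := fun i => by
    simp only [Pi.add_apply, Pi.smul_apply, liftSite, smul_eq_mul, e_apply, towerP_apply]
    have hz : (z i : ℕ) + 1 ≤ L ^ (j + 1) * m i := Nat.succ_le_of_lt (lt_of_lt_of_eq (z i).isLt (towerP_apply L m (j + 1) i))
    have hzi : (L : ℤ) ^ (n - j) * ((z i : ℕ) + 1) ≤ (L : ℤ) ^ (n + 1) * m i := by
      have := Nat.mul_le_mul_left (L ^ (n - j)) hz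
      rw [← mul_assoc, hpow] at this
      exact_mod_cast this
    split_ifs
    · push_cast; have : (t : ℤ) < (L : ℤ) ^ (n - j) := by exact_mod_cast ht
      nlinarith
    · push_cast; nlinarith
  rw [val_perSite_of_lt h0 hw]
  simp [liftSite, e_apply]

omit [NeZero L] [∀ i, NeZero (m i)] in
/-- `liftSite (x − x₀)_i = x_i − x₀_i` when `x₀ ≤ x` coordinatewise. [folklore] -/
private theorem liftSite_sub_of_le {P : Fin d → ℕ} (x₀ x : TSite d P) (h : ∀ i, (x₀ i : ℕ) ≤ (x i : ℕ)) (i : Fin d) :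
    liftSite (x - x₀) i = ((x i : ℕ) : ℤ) - ((x₀ i : ℕ) : ℤ) := by
  simp only [liftSite, Pi.sub_apply]
  rw [Fin.coe_sub_iff_le.2 (h i)]
  push_cast [Nat.cast_sub (h i)]
  ring

/-- **EVERY FINE BOND OF THE STRAIGHT CONTOUR OF A LEVEL BOND OVER `y`, STEPPING INSIDE `y`, LIES IN THE BOX `x₀(y) + [0, N − 1]^d`** (the hypothesis
shape of `B7Eq44TorusAxialGaugeLocal.norm_gaugeU_axialGaugeTAt_sub_one_le_uniform` with `n_i = N − 1`). [cite: Balaban1985Averaging, p.24–25] -/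
theorem segBond_in_box (hm : ∀ i, 2 ≤ m i) (y : TSite d m) {j : ℕ} (hj : j ≤ n) (z : TSite d (towerP L m (j + 1))) (κ : Fin d)
    (hz : ∀ i, (z i : ℕ) / L ^ (j + 1) = (y i : ℕ)) (hzκ : ∀ i, ((shift κ z) i : ℕ) / L ^ (j + 1) = (y i : ℕ)) {t : ℕ} (ht : t < L ^ (n - j)) :
    liftSite (perSite (towerP L m (n + 1)) (((L : ℤ) ^ (n - j)) • liftSite z + (t : ℤ) • e κ) -
        perSite (towerP L m (n + 1)) (((L : ℤ) ^ (n + 1)) • liftSite y)) + e κ ≤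
      fun _ => ((L ^ (n + 1) : ℕ) : ℤ) - 1 := by
  have hpow : L ^ (n - j) * L ^ (j + 1) = L ^ (n + 1) := by rw [← pow_add]; congr 1; omega
  have hLp : (0 : ℤ) < (L : ℤ) ^ (n - j) := pow_pos (by exact_mod_cast Nat.pos_of_ne_zero (NeZero.ne L)) _
  set x₀ := perSite (towerP L m (n + 1)) (((L : ℤ) ^ (n + 1)) • liftSite y) with hx₀
  set x := perSite (towerP L m (n + 1)) (((L : ℤ) ^ (n - j)) • liftSite z + (t : ℤ) • e κ) with hx
  have e1 : ∀ i, ((x₀ i : ℕ) : ℤ) = (L : ℤ) ^ (n + 1) * (y i : ℕ) := fun i => by rw [hx₀]; exact val_blockOrigin L m n y i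
  have e2 : ∀ i, ((x i : ℕ) : ℤ) = (L : ℤ) ^ (n - j) * (z i : ℕ) + (if i = κ then (t : ℤ) else 0) := fun i => by
    rw [hx]; exact val_segSite L m n hj z κ ht i
  have hlow : ∀ i, (L : ℤ) ^ (n + 1) * (y i : ℕ) ≤ (L : ℤ) ^ (n - j) * (z i : ℕ) := fun i => by
    have := Nat.mul_le_mul_left (L ^ (n - j)) (bounds_of_over L m hz i).1
    rw [← mul_assoc, hpow] at this
    exact_mod_cast this
  -- `x₀ ≤ x` coordinatewise
  have hle : ∀ i, (x₀ i : ℕ) ≤ (x i : ℕ) := fun i => by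
    have : ((x₀ i : ℕ) : ℤ) ≤ ((x i : ℕ) : ℤ) := by rw [e1, e2]; split_ifs <;> linarith [hlow i]
    exact_mod_cast this
  intro i
  rw [Pi.add_apply, liftSite_sub_of_le x₀ x hle i, e1, e2, e_apply]
  obtain ⟨_, h2⟩ := bounds_of_over L m hz i
  by_cases hi : i = κ
  · subst hi
    simp only [if_true]
    have h3 := succ_lt_of_over_shift L m hm hz i hzκ
    -- `L^{n−j}(z_κ + 1) + 1 ≤ L^{n+1}(y_κ + 1)`, `t + 1 ≤ L^{n−j}`
    have h4 : (L : ℤ) ^ (n - j) * ((z i : ℕ) + 1) + (L : ℤ) ^ (n - j) ≤ (L : ℤ) ^ (n + 1) * ((y i : ℕ) + 1) := by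
      have h5 : L ^ (n - j) * ((z i : ℕ) + 2) ≤ L ^ (n - j) * (L ^ (j + 1) * ((y i : ℕ) + 1)) := Nat.mul_le_mul_left _ (by omega)
      rw [← mul_assoc, hpow] at h5
      have : (L : ℤ) ^ (n - j) * ((z i : ℕ) + 2) ≤ (L : ℤ) ^ (n + 1) * ((y i : ℕ) + 1) := by exact_mod_cast h5
      linarith
    have ht' : (t : ℤ) + 1 ≤ (L : ℤ) ^ (n - j) := by exact_mod_cast ht
    push_cast
    linarith
  · simp only [hi, if_false, add_zero]
    have h4 : (L : ℤ) ^ (n - j) * ((z i : ℕ) + 1) ≤ (L : ℤ) ^ (n + 1) * ((y i : ℕ) + 1) := by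
      have h5 : L ^ (n - j) * ((z i : ℕ) + 1) ≤ L ^ (n - j) * (L ^ (j + 1) * ((y i : ℕ) + 1)) := Nat.mul_le_mul_left _ (by omega)
      rw [← mul_assoc, hpow] at h5
      exact_mod_cast h5
    have hL1 : (1 : ℤ) ≤ (L : ℤ) ^ (n - j) := by exact_mod_cast Nat.one_le_pow _ _ (Nat.pos_of_ne_zero (NeZero.ne L))
    push_cast
    linarith

end Arith

/-! ## §2 Fine bonds and straight transporters in the block's axial gauge: the LENGTH count -/

section Fine

variable {𝔸 : Type*} [NormedRing 𝔸] [NormOneClass 𝔸] {U : Bond d (towerP L m (n + 1)) → 𝔸ˣ} (hU : ∀ b, U b ∈ U1 𝔸) {δ : ℝ} (hδ0 : 0 ≤ δ)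
  (hδ : ∀ (x : TSite d (towerP L m (n + 1))) (κ μ : Fin d) (hκμ : κ < μ), ‖(plaqHolU U (x, ⟨(κ, μ), hκμ⟩) : 𝔸) - 1‖ ≤ δ)
  (hm : ∀ i, 2 ≤ m i) (y : TSite d m)

omit [NeZero L] in
/-- the box `x₀(y) + [0, N − 1]^d` does not wrap: `(N − 1) + 1 ≤ N·m_i`. [folklore] -/
private theorem box_extents_le (i : Fin d) : (fun _ : Fin d => ((L ^ (n + 1) : ℕ) : ℤ) - 1) i + 1 ≤ towerP L m (n + 1) i := by
  have h : L ^ (n + 1) * 1 ≤ L ^ (n + 1) * m i := Nat.mul_le_mul_left _ (Nat.one_le_iff_ne_zero.2 (NeZero.ne (m i)))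
  have : ((L ^ (n + 1) : ℕ) : ℤ) ≤ ((L ^ (n + 1) * m i : ℕ) : ℤ) := by exact_mod_cast (by simpa using h)
  simp only [towerP_apply]; push_cast at this ⊢; linarith

include hU hδ0 hδ hm in
/-- **THE STRAIGHT TRANSPORTER OF A LEVEL BOND OVER `y` IN THE BLOCK's AXIAL GAUGE IS `ℓ·d(N−1)δ`-CLOSE TO `1`** (`ℓ = L^{n−j}` fine bonds, each in the
box, each `|n|₁δ = d(N−1)δ`-close by p. 25's axial estimate; telescoping in the unit ball). [cite: Balaban1985Averaging, pp.24–25, (9) p.18] -/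
theorem norm_hol_seg_blockAxial_sub_one_le {j : ℕ} (hj : j ≤ n) (z : TSite d (towerP L m (j + 1))) (κ : Fin d)
    (hz : ∀ i, (z i : ℕ) / L ^ (j + 1) = (y i : ℕ)) (hzκ : ∀ i, ((shift κ z) i : ℕ) / L ^ (j + 1) = (y i : ℕ)) :
    ∀ ℓ : ℕ, ℓ ≤ L ^ (n - j) →
      ‖((hol (perCfg (towerP L m (n + 1)) (gaugeU (axialGaugeTAt (towerP L m (n + 1)) U
          (perSite (towerP L m (n + 1)) (((L : ℤ) ^ (n + 1)) • liftSite y))) U))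
          (((L : ℤ) ^ (n - j)) • liftSite z) (seg κ (ℓ : ℤ)) : 𝔸ˣ) : 𝔸) - 1‖ ≤
        ℓ * ((l1 (fun _ : Fin d => ((L ^ (n + 1) : ℕ) : ℤ) - 1) : ℝ) * δ)
  | 0, _ => by simp
  | ℓ + 1, hℓ => by
    set x₀ := perSite (towerP L m (n + 1)) (((L : ℤ) ^ (n + 1)) • liftSite y) with hx₀
    set V := perCfg (towerP L m (n + 1)) (gaugeU (axialGaugeTAt (towerP L m (n + 1)) U x₀) U) with hV
    have ih := norm_hol_seg_blockAxial_sub_one_le hj z κ hz hzκ ℓ (Nat.le_of_succ_le hℓ)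
    have hVU1 : ∀ (x : B7Prop1Explicit.Site d) (μ : Fin d), V x μ ∈ U1 𝔸 := fun x μ => by
      rw [hV, perCfg_apply, gaugeU_apply_dir]
      exact (U1 𝔸).mul_mem ((U1 𝔸).mul_mem (B7Eq44TorusAxialGaugeLocal.axialGaugeTAt_mem_U1 (towerP L m (n + 1)) hU x₀ _) (hU _))
        ((U1 𝔸).inv_mem (B7Eq44TorusAxialGaugeLocal.axialGaugeTAt_mem_U1 (towerP L m (n + 1)) hU x₀ _))
    -- the last bond lies in the box
    have hbox := segBond_in_box L m n hm y hj z κ hz hzκ (t := ℓ) (by omega)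
    have hbond := norm_gaugeU_axialGaugeTAt_sub_one_le_uniform (towerP L m (n + 1)) hU x₀ (n := fun _ : Fin d => ((L ^ (n + 1) : ℕ) : ℤ) - 1)
      (fun i => box_extents_le L m n i) (δ := δ) (fun x κ' μ hκμ _ => hδ x κ' μ hκμ) hδ0 _ κ hbox
    rw [show ((ℓ + 1 : ℕ) : ℤ) = (ℓ : ℤ) + 1 by push_cast; rfl, hol_seg_succ, Units.val_mul]
    have hlast : ‖((V (((L : ℤ) ^ (n - j)) • liftSite z + (ℓ : ℤ) • e κ) κ : 𝔸ˣ) : 𝔸) - 1‖ ≤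
        (l1 (fun _ : Fin d => ((L ^ (n + 1) : ℕ) : ℤ) - 1) : ℝ) * δ := by
      rw [hV, perCfg_apply]; exact hbond
    have hP1 : ‖((hol V (((L : ℤ) ^ (n - j)) • liftSite z) (seg κ (ℓ : ℤ)) : 𝔸ˣ) : 𝔸)‖ ≤ 1 := (mem_U1.1 (hol_mem hVU1 _ _)).1
    calc _ ≤ ‖((hol V (((L : ℤ) ^ (n - j)) • liftSite z) (seg κ (ℓ : ℤ)) : 𝔸ˣ) : 𝔸) - 1‖ +
          ‖((V (((L : ℤ) ^ (n - j)) • liftSite z + (ℓ : ℤ) • e κ) κ : 𝔸ˣ) : 𝔸) - 1‖ := by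
          -- `‖Pa − 1‖ ≤ ‖P − 1‖ + ‖a − 1‖` for `‖P‖ ≤ 1`
          set Pm := ((hol V (((L : ℤ) ^ (n - j)) • liftSite z) (seg κ (ℓ : ℤ)) : 𝔸ˣ) : 𝔸)
          set a := ((V (((L : ℤ) ^ (n - j)) • liftSite z + (ℓ : ℤ) • e κ) κ : 𝔸ˣ) : 𝔸)
          have e : Pm * a - 1 = Pm * (a - 1) + (Pm - 1) := by noncomm_ring
          rw [e]
          refine (norm_add_le _ _).trans ?_
          have := (norm_mul_le Pm (a - 1)).trans (mul_le_of_le_one_left (norm_nonneg _) hP1)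
          linarith
      _ ≤ ℓ * ((l1 (fun _ : Fin d => ((L ^ (n + 1) : ℕ) : ℤ) - 1) : ℝ) * δ) + (l1 (fun _ : Fin d => ((L ^ (n + 1) : ℕ) : ℤ) - 1) : ℝ) * δ :=
          add_le_add ih hlast
      _ = (ℓ + 1 : ℕ) * ((l1 (fun _ : Fin d => ((L ^ (n + 1) : ℕ) : ℤ) - 1) : ℝ) * δ) := by push_cast; ring

include hU hδ0 hδ hm in
/-- **FINE BONDS IN THE BLOCK's AXIAL GAUGE**: every fine bond `(x, μ)` with `x` and `x + e_μ` over `y` satisfies `‖U^{u_y}(x, μ) − 1‖ ≤ |n|₁·δ`,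
`|n|₁ = d(N − 1)` — print's «|V₀,b − 1| < |b₋ − y|α₀ ≦ dLα₀» for the unit block of `T_{L^{n+1}m}`. [cite: Balaban1985Averaging, pp.24–25; Balaban1985BackgroundPropagators, (3.35) p.396] -/
theorem norm_gaugeU_blockAxial_sub_one_le (x : TSite d (towerP L m (n + 1))) (μ : Fin d)
    (hx : ∀ i, (x i : ℕ) / L ^ (n + 1) = (y i : ℕ)) (hxμ : ∀ i, ((shift μ x) i : ℕ) / L ^ (n + 1) = (y i : ℕ)) :
    ‖((gaugeU (axialGaugeTAt (towerP L m (n + 1)) U (perSite (towerP L m (n + 1)) (((L : ℤ) ^ (n + 1)) • liftSite y))) U (x, μ) : 𝔸ˣ) : 𝔸) - 1‖ ≤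
      (l1 (fun _ : Fin d => ((L ^ (n + 1) : ℕ) : ℤ) - 1) : ℝ) * δ := by
  have h := norm_hol_seg_blockAxial_sub_one_le L m n hU hδ0 hδ hm y (j := n) le_rfl x μ hx hxμ 1 (Nat.one_le_pow _ _ (Nat.pos_of_ne_zero (NeZero.ne L)))
  simp only [Nat.sub_self, pow_zero, one_smul, Nat.cast_one, one_mul] at h
  have hone : hol (perCfg (towerP L m (n + 1)) (gaugeU (axialGaugeTAt (towerP L m (n + 1)) U
      (perSite (towerP L m (n + 1)) (((L : ℤ) ^ (n + 1)) • liftSite y))) U)) (liftSite x) (seg μ (1 : ℤ)) =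
      gaugeU (axialGaugeTAt (towerP L m (n + 1)) U (perSite (towerP L m (n + 1)) (((L : ℤ) ^ (n + 1)) • liftSite y))) U (x, μ) := by
    rw [show (1 : ℤ) = 0 + 1 from (zero_add 1).symm, hol_seg_succ, seg_zero, hol_nil, one_mul, zero_smul, add_zero, perCfg_apply, perSite_liftSite]
  rw [hone] at h
  exact h

end Fine

/-! ## §3 Level bonds in the block's axial gauge: LENGTH + AREA -/

section Level

variable {𝔸 : Type*} [NormedRing 𝔸] [NormOneClass 𝔸] [NormedAlgebra ℂ 𝔸] [CompleteSpace 𝔸] (hL : 2 ≤ L) {S : Subgroup 𝔸ˣ} (hS : AvgClosed d L S)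
  {U : Bond d (towerP L m (n + 1)) → 𝔸ˣ} (hU : ∀ b, U b ∈ S) {α₀ : ℝ} (hα : 0 < α₀) (hα3 : C0 d * α₀ ≤ 1 / 3) (hα2 : 2 * α₀ ≤ c2' d L)
  (h52 : pdev (perCfg (towerP L m (n + 1)) U) < α₀ * (((L : ℝ) ^ (n + 1))⁻¹) ^ 2) (hm : ∀ i, 2 ≤ m i) (y : TSite d m)

include hL hS hU hα hα3 hα2 h52 hm in
/-- **LEVEL BONDS IN THE BLOCK's AXIAL GAUGE, FROM THE CLASS (52) ALONE**: for `j ≤ n` and a level-`(j+1)` bond `(z, κ)` with `z`, `z + e_κ` over the unit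
site `y`, in the axial gauge `u_y` rooted at the block origin,
`‖(UlevOf L m (n+1) (U^{u_y}) j)(z, κ) − 1‖ ≤ L^{n−j}·d(N−1)·pdev Ũ + 256(d+1)(d+4)·α₀·(L^{n−j}∕N)²`, `N = L^{n+1}` — LENGTH (§2, with `δ := pdev Ũ` through
`hol_perCfg_plaqWord` ∕ `le_pdev`) + AREA (`B7Eq47AveragedBondVsStraight.norm_avgIter_sub_straight_le` at `Ũ^{ũ_y}`: same class, `pdev_gaugeAct`; values in `S`
since the axial gauge is a holonomy of `U`). [cite: Balaban1985Averaging, pp.24–26, (43), (47), (52)–(54); Balaban1985BackgroundPropagators, (3.35)–(3.37) p.396] -/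
theorem norm_UlevOf_blockAxial_sub_one_le {j : ℕ} (hj : j ≤ n) (z : TSite d (towerP L m (j + 1))) (κ : Fin d)
    (hz : ∀ i, (z i : ℕ) / L ^ (j + 1) = (y i : ℕ)) (hzκ : ∀ i, ((shift κ z) i : ℕ) / L ^ (j + 1) = (y i : ℕ)) :
    ‖((UlevOf L m (n + 1) (gaugeU (axialGaugeTAt (towerP L m (n + 1)) U (perSite (towerP L m (n + 1)) (((L : ℤ) ^ (n + 1)) • liftSite y))) U)
        j (z, κ) : 𝔸ˣ) : 𝔸) - 1‖ ≤
      (L : ℝ) ^ (n - j) * ((l1 (fun _ : Fin d => ((L ^ (n + 1) : ℕ) : ℤ) - 1) : ℝ) * pdev (perCfg (towerP L m (n + 1)) U)) +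
        256 * (d + 1) * (d + 4) * α₀ * ((L : ℝ) ^ (n - j) * ((L : ℝ) ^ (n + 1))⁻¹) ^ 2 := by
  set x₀ := perSite (towerP L m (n + 1)) (((L : ℤ) ^ (n + 1)) • liftSite y) with hx₀
  set g := axialGaugeTAt (towerP L m (n + 1)) U x₀ with hg
  set V := perCfg (towerP L m (n + 1)) (gaugeU g U) with hV
  have hSU1 : S ≤ U1 𝔸 := hS.le_U1
  have hU1 : ∀ b, U b ∈ U1 𝔸 := fun b => hSU1 (hU b)
  -- the gauge is `S`-valued (a holonomy of `U`), so `U^{u}` and its periodic extension are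
  have hgS : ∀ x, g x ∈ S := fun x => by
    rw [hg, axialGaugeTAt_apply]
    exact hol_mem_of (fun z κ => by rw [perCfg_apply]; exact hU _) _ _
  have hVS : ∀ (x : B7Prop1Explicit.Site d) (μ : Fin d), V x μ ∈ S := fun x μ => by
    rw [hV, perCfg_apply, gaugeU_apply_dir]
    exact S.mul_mem (S.mul_mem (hgS _) (hU _)) (S.inv_mem (hgS _))
  -- same class: `pdev(Ũ^{ũ}) = pdev Ũ`
  have hpdev : pdev V = pdev (perCfg (towerP L m (n + 1)) U) := by
    rw [hV, perCfg_gaugeU']; exact pdev_gaugeAct (fun z => hSU1 (hgS _)) _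
  have h52' : pdev V < α₀ * (((L : ℝ) ^ (n + 1))⁻¹) ^ 2 := by rw [hpdev]; exact h52
  -- the torus plaquettes are bounded by `pdev Ũ`
  have hδ0 : 0 ≤ pdev (perCfg (towerP L m (n + 1)) U) := B7Prop2Explicit.pdev_nonneg _
  have hVU : ∀ (z : B7Prop1Explicit.Site d) (ν : Fin d), perCfg (towerP L m (n + 1)) U z ν ∈ U1 𝔸 := fun z ν => by
    rw [perCfg_apply]; exact hU1 _
  have hδ : ∀ (x : TSite d (towerP L m (n + 1))) (κ' μ : Fin d) (hκμ : κ' < μ),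
      ‖(plaqHolU U (x, ⟨(κ', μ), hκμ⟩) : 𝔸) - 1‖ ≤ pdev (perCfg (towerP L m (n + 1)) U) := by
    intro x κ' μ hκμ
    have h := le_pdev hVU (liftSite x) κ' μ
    rwa [hol_perCfg_plaqWord (towerP L m (n + 1)) U (liftSite x) hκμ, perSite_liftSite] at h
  -- LENGTH: the straight transporter
  have hlen := norm_hol_seg_blockAxial_sub_one_le L m n hU1 hδ0 hδ hm y hj z κ hz hzκ (L ^ (n - j)) le_rfl
  -- AREA: the averaged bond against the straight transporter (T1 at `Ũ^{ũ}`, `j′ = n − j ≤ n + 1` steps)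
  have harea := norm_avgIter_sub_straight_le L hL hS (n + 1) V hVS hα hα3 hα2 h52' (n - j) (by omega) (liftSite z) κ
  -- `UlevOf … j (z, κ) = avgIter L V (n − j) (liftSite z) κ`
  have hU' : UlevOf L m (n + 1) (gaugeU g U) j (z, κ) = avgIter L V (n - j) (liftSite z) κ := by
    rw [UlevOf, show n + 1 - 1 - j = n - j by omega]
  rw [hU']
  have hcast : ((L ^ (n - j) : ℕ) : ℤ) = (L : ℤ) ^ (n - j) := by push_cast; rfl
  rw [hcast] at harea hlen
  calc ‖((avgIter L V (n - j) (liftSite z) κ : 𝔸ˣ) : 𝔸) - 1‖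
      ≤ ‖((avgIter L V (n - j) (liftSite z) κ : 𝔸ˣ) : 𝔸) - ((hol V (((L : ℤ) ^ (n - j)) • liftSite z) (seg κ ((L : ℤ) ^ (n - j))) : 𝔸ˣ) : 𝔸)‖ +
          ‖((hol V (((L : ℤ) ^ (n - j)) • liftSite z) (seg κ ((L : ℤ) ^ (n - j))) : 𝔸ˣ) : 𝔸) - 1‖ := norm_sub_le_norm_sub_add_norm_sub _ _ _
    _ ≤ 256 * (d + 1) * (d + 4) * α₀ * ((L : ℝ) ^ (n - j) * ((L : ℝ) ^ (n + 1))⁻¹) ^ 2 +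
          (L ^ (n - j) : ℕ) * ((l1 (fun _ : Fin d => ((L ^ (n + 1) : ℕ) : ℤ) - 1) : ℝ) * pdev (perCfg (towerP L m (n + 1)) U)) :=
          add_le_add harea hlen
    _ = _ := by push_cast; ring


omit [NeZero L] [∀ i, NeZero (m i)] in
/-- `|n|₁ ≤ d·N` for the box extents `n_i = N − 1`. [folklore] -/
private theorem l1_box_le (N : ℕ) (hN : 1 ≤ N) : (l1 (fun _ : Fin d => ((N : ℕ) : ℤ) - 1) : ℝ) ≤ d * N := by
  unfold l1
  rw [Finset.sum_const, Finset.card_univ, Fintype.card_fin, smul_eq_mul]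
  have e : ((N : ℕ) : ℤ) - 1 = ((N - 1 : ℕ) : ℤ) := by omega
  rw [e, Int.natAbs_natCast]
  push_cast
  have : ((N - 1 : ℕ) : ℝ) ≤ N := by exact_mod_cast Nat.sub_le N 1
  exact mul_le_mul_of_nonneg_left this (Nat.cast_nonneg d)

include hL hS hU hα hα3 hα2 h52 hm in
/-- **THE PROFILE, LEVEL-FREE: `‖(UlevOf (U^{u_y}) j)(z, κ) − 1‖ ≤ (d + 256(d+1)(d+4))·α₀·L^{n−j}∕N`** (`N = L^{n+1}`; `pdev Ũ < α₀N⁻²`, `|n|₁ ≤ dN`,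
`(L^{n−j}∕N)² ≤ L^{n−j}∕N`) — the chain's displayed `ε_j` over the block with ratio `1∕L` per level towards the coarse end: `j = n` (finest): `C·α₀∕N`;
`j = 0` (coarsest): `C·α₀∕L`.  NO level count, NO volume, nothing but (52) and `2 ≤ m_i`. [cite: Balaban1985Averaging, pp.24–26, (52)–(54); Balaban1985BackgroundPropagators, (3.37) p.396] -/
theorem norm_UlevOf_blockAxial_sub_one_le_profile {j : ℕ} (hj : j ≤ n) (z : TSite d (towerP L m (j + 1))) (κ : Fin d)
    (hz : ∀ i, (z i : ℕ) / L ^ (j + 1) = (y i : ℕ)) (hzκ : ∀ i, ((shift κ z) i : ℕ) / L ^ (j + 1) = (y i : ℕ)) :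
    ‖((UlevOf L m (n + 1) (gaugeU (axialGaugeTAt (towerP L m (n + 1)) U (perSite (towerP L m (n + 1)) (((L : ℤ) ^ (n + 1)) • liftSite y))) U)
        j (z, κ) : 𝔸ˣ) : 𝔸) - 1‖ ≤
      ((d : ℝ) + 256 * (d + 1) * (d + 4)) * α₀ * ((L : ℝ) ^ (n - j) * ((L : ℝ) ^ (n + 1))⁻¹) := by
  have h := norm_UlevOf_blockAxial_sub_one_le L m n hL hS hU hα hα3 hα2 h52 hm y hj z κ hz hzκ
  have hL0 : (0 : ℝ) < L := by exact_mod_cast lt_of_lt_of_le (by norm_num) hL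
  have hN : (0 : ℝ) < (L : ℝ) ^ (n + 1) := pow_pos hL0 _
  have hNj : (0 : ℝ) < (L : ℝ) ^ (n - j) := pow_pos hL0 _
  set r : ℝ := (L : ℝ) ^ (n - j) * ((L : ℝ) ^ (n + 1))⁻¹ with hr
  have hr0 : 0 ≤ r := by rw [hr]; positivity
  have hr1 : r ≤ 1 := by
    rw [hr, ← div_eq_mul_inv, div_le_one hN]
    exact pow_le_pow_right₀ (by exact_mod_cast le_trans (by norm_num) hL) (by omega)
  -- `|n|₁·pdev ≤ dN·α₀N⁻² = dα₀N⁻¹`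
  have hl1 := l1_box_le (d := d) (L ^ (n + 1)) (Nat.one_le_pow _ _ (Nat.pos_of_ne_zero (NeZero.ne L)))
  have hδ0 : 0 ≤ pdev (perCfg (towerP L m (n + 1)) U) := B7Prop2Explicit.pdev_nonneg _
  have hcastN : ((L ^ (n + 1) : ℕ) : ℝ) = (L : ℝ) ^ (n + 1) := by push_cast; rfl
  rw [hcastN] at hl1
  have h1 : (L : ℝ) ^ (n - j) * ((l1 (fun _ : Fin d => ((L ^ (n + 1) : ℕ) : ℤ) - 1) : ℝ) * pdev (perCfg (towerP L m (n + 1)) U)) ≤ d * α₀ * r := by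
    have ha : (l1 (fun _ : Fin d => ((L ^ (n + 1) : ℕ) : ℤ) - 1) : ℝ) * pdev (perCfg (towerP L m (n + 1)) U) ≤
        (d * (L : ℝ) ^ (n + 1)) * (α₀ * (((L : ℝ) ^ (n + 1))⁻¹) ^ 2) := mul_le_mul hl1 h52.le hδ0 (by positivity)
    have e : (L : ℝ) ^ (n - j) * ((d * (L : ℝ) ^ (n + 1)) * (α₀ * (((L : ℝ) ^ (n + 1))⁻¹) ^ 2)) = d * α₀ * r := by
      rw [hr]; field_simp
    rw [← e]
    exact mul_le_mul_of_nonneg_left ha hNj.le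
  have h2 : 256 * (d + 1) * (d + 4) * α₀ * r ^ 2 ≤ 256 * (d + 1) * (d + 4) * α₀ * r := by
    have : r ^ 2 ≤ r := by nlinarith
    exact mul_le_mul_of_nonneg_left this (by positivity)
  calc _ ≤ d * α₀ * r + 256 * (d + 1) * (d + 4) * α₀ * r := h.trans (add_le_add h1 h2)
    _ = ((d : ℝ) + 256 * (d + 1) * (d + 4)) * α₀ * r := by ring

end Level

end Literature.MathematicalPhysics.QuantumFieldTheory.Balaban1983to89.B7Eq47BlockGaugeTowerBonds

end
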